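import Literature.Computability.AlgebraicComplexity.LMR13PLambdaStabilizerBlockII
import HarnessLib

/-!
# LMR13 §3.5, stabiliser of `P_Λ`: the rank-one adjugates `adj(A(Ω,y)) = det Ω · y yᵀ` (step (D3))

[topic Computability/AlgebraicComplexity]

Landsberg–Manivel–Ressayre 2013, §3.5 (journal p. 481; arXiv:1004.4802 `p0008.txt:L82–88`): the stabiliser
count for `P_Λ(A+S) = (1/n)·tr(adj(A)·S)`. In the cell's elementary route (memo
`HOME/lmr/X3b-ELEMENTARY-ROUTE-t10g4.md` §1 (D3)) the three block identities (`pLambda_glAnn_blocks`) are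
evaluated at the corank-one skew test points
`A(Ω,y) := R_r(Ω) + e_r ∧ (R_r(Ω)·y) = g · R_r(Ω) · gᵀ`, `g = 1 − e_r (y − e_r)ᵀ` (`y_r = 1`), whose adjugate is
the rank-one matrix **`det Ω · y yᵀ`** (`adjugate_padAt_add_wedge`). Consequence (the «(c)» lemma of the cell
bus): a symmetric matrix `N` with `tr(adj(A)·N) = 0` for every skew `A` vanishes
(`eq_zero_of_forall_skew_trace_adjugate_mul`, `n = h+h+1 ≥ 3`) — the `(L_X S)_sym` half of block (III) once
`(L_X A)_skew = 0`, and the test families T2–T4 of block (I).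

Everything is PROVED; theorems only (no `def`); no named fact. Honest framing: a step of (X3b);
`LMR2013_prop_3_5_1` remains OPEN in the tree for `n > 3`; VP ≠ VNP is NOT proved and nothing here is progress on it.

## References

* [LandsbergManivelRessayre2013] J. M. Landsberg, L. Manivel, N. Ressayre, *Hypersurfaces with degenerate duals and
  the geometric complexity theory program*, Comment. Math. Helv. 88 (2013) 469–484, §3.5 (p. 481).
-/

noncomputable section

open Matrix

namespace Literature.Computability.AlgebraicComplexity

namespace SkewAdj

variable {m : ℕ}

/-! ### The unipotent conjugator `g = 1 − e_r zᵀ` -/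

/-- A quadratic form of a skew matrix vanishes: `v ⬝ (M v) = 0` when `Mᵀ = −M`.
[cite: LandsbergManivelRessayre2013, §3.5 (p. 481)] -/
theorem dotProduct_mulVec_self_eq_zero_of_transpose_eq_neg {n : Type*} [Fintype n]
    {M : Matrix n n ℂ} (hM : Mᵀ = -M) (v : n → ℂ) : v ⬝ᵥ (M *ᵥ v) = 0 := by
  have h1 : v ⬝ᵥ (M *ᵥ v) = (Mᵀ *ᵥ v) ⬝ᵥ v := by
    rw [Matrix.dotProduct_mulVec, Matrix.mulVec_transpose]
  rw [hM, Matrix.neg_mulVec, neg_dotProduct, dotProduct_comm (M *ᵥ v) v] at h1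
  linear_combination h1 / 2

/-- The padded matrix kills `e_r`: `R_r(Ω) · e_r = 0` (its column `r` vanishes).
[cite: LandsbergManivelRessayre2013, §3.5 (p. 481)] -/
theorem padAt_mulVec_single (r : Fin (m + 1)) (Ω : Matrix (Fin m) (Fin m) ℂ) (c : ℂ) :
    padAt r Ω *ᵥ Pi.single r c = 0 := by
  ext i
  simp only [Matrix.mulVec, dotProduct_single, padAt_apply_right, zero_mul, Pi.zero_apply]

/-- **The test point is a congruence transform of the padded matrix**: with `e = e_r`, `z = y − e_r`
(`y_r = 1`) and `u = R_r(Ω)·y`,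
`(1 − e zᵀ) · R_r(Ω) · (1 − e zᵀ)ᵀ = R_r(Ω) + e uᵀ − u eᵀ` for skew `Ω`.
[cite: LandsbergManivelRessayre2013, §3.5 (p. 481)] -/
theorem conj_padAt_eq (r : Fin (m + 1)) {Ω : Matrix (Fin m) (Fin m) ℂ} (hΩ : Ωᵀ = -Ω)
    (y : Fin (m + 1) → ℂ) (hy : y r = 1) :
    (1 - vecMulVec (Pi.single r (1 : ℂ)) (y - Pi.single r 1)) * padAt r Ω *
        (1 - vecMulVec (Pi.single r (1 : ℂ)) (y - Pi.single r 1))ᵀ =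
      padAt r Ω + (vecMulVec (Pi.single r (1 : ℂ)) (padAt r Ω *ᵥ y) -
        vecMulVec (padAt r Ω *ᵥ y) (Pi.single r (1 : ℂ))) := by
  set e : Fin (m + 1) → ℂ := Pi.single r 1 with he
  set z : Fin (m + 1) → ℂ := y - e with hz
  set R₀ := padAt r Ω with hR₀
  have hR₀T : R₀ᵀ = -R₀ := by
    rw [hR₀, padAt_transpose, hΩ]
    ext a b
    rcases Fin.eq_self_or_eq_succAbove r a with rfl | ⟨a', rfl⟩
    · simp
    · rcases Fin.eq_self_or_eq_succAbove r b with rfl | ⟨b', rfl⟩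
      · simp
      · simp
  have hRz : R₀ *ᵥ z = R₀ *ᵥ y := by
    rw [hz, Matrix.mulVec_sub, hR₀, padAt_mulVec_single, sub_zero]
  have hzR : z ᵥ* R₀ = -(R₀ *ᵥ y) := by
    rw [← hRz, ← Matrix.mulVec_transpose, hR₀T, Matrix.neg_mulVec]
  have hquad : (R₀ *ᵥ y) ⬝ᵥ z = 0 := by
    rw [← hRz, dotProduct_comm]
    exact dotProduct_mulVec_self_eq_zero_of_transpose_eq_neg hR₀T z
  have h0 : vecMulVec e (0 : Fin (m + 1) → ℂ) = 0 := by
    ext i j; simp [Matrix.vecMulVec_apply]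
  have h1 : (1 - vecMulVec e z) * R₀ = R₀ + vecMulVec e (R₀ *ᵥ y) := by
    rw [Matrix.sub_mul, Matrix.one_mul, Matrix.vecMulVec_mul, hzR]
    have hneg : vecMulVec e (-(R₀ *ᵥ y)) = -vecMulVec e (R₀ *ᵥ y) := by
      ext i j; simp [Matrix.vecMulVec_apply]
    rw [hneg, sub_neg_eq_add]
  have h2 : (R₀ + vecMulVec e (R₀ *ᵥ y)) * (1 - vecMulVec e z)ᵀ =
      R₀ + vecMulVec e (R₀ *ᵥ y) - vecMulVec (R₀ *ᵥ y) e := by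
    rw [Matrix.transpose_sub, Matrix.transpose_one, Matrix.transpose_vecMulVec, Matrix.mul_sub, Matrix.mul_one,
      Matrix.add_mul, Matrix.mul_vecMulVec, hRz, Matrix.vecMulVec_mul_vecMulVec, hquad, zero_smul, h0, add_zero]
  rw [h1, h2]
  abel

/-- `det (1 − e_r zᵀ) = 1` when `z_r = 0`. [cite: LandsbergManivelRessayre2013, §3.5 (p. 481)] -/
theorem det_one_sub_vecMulVec_single (r : Fin (m + 1)) (z : Fin (m + 1) → ℂ) (hz : z r = 0) :
    (1 - vecMulVec (Pi.single r (1 : ℂ)) z).det = 1 := by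
  rw [Matrix.vecMulVec_eq (ι := Unit), Matrix.det_one_sub_mul_comm, Matrix.det_unique, Matrix.sub_apply,
    Matrix.one_apply_eq, Matrix.replicateRow_mul_replicateCol_apply, dotProduct_single, hz, zero_mul, sub_zero]

/-- `(1 − e_r zᵀ)(1 + e_r zᵀ) = 1` when `z_r = 0`. [cite: LandsbergManivelRessayre2013, §3.5 (p. 481)] -/
theorem one_sub_vecMulVec_mul_one_add (r : Fin (m + 1)) (z : Fin (m + 1) → ℂ) (hz : z r = 0) :
    (1 - vecMulVec (Pi.single r (1 : ℂ)) z) * (1 + vecMulVec (Pi.single r (1 : ℂ)) z) = 1 := by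
  rw [Matrix.sub_mul, Matrix.one_mul, Matrix.mul_add, Matrix.mul_one, Matrix.vecMulVec_mul_vecMulVec,
    dotProduct_single, hz, zero_mul, zero_smul]
  have h0 : vecMulVec (Pi.single r (1 : ℂ)) (0 : Fin (m + 1) → ℂ) = 0 := by
    ext i j; simp [Matrix.vecMulVec_apply]
  rw [h0]
  abel

/-- `adj(1 − e_r zᵀ) = 1 + e_r zᵀ` when `z_r = 0`. [cite: LandsbergManivelRessayre2013, §3.5 (p. 481)] -/
theorem adjugate_one_sub_vecMulVec_single (r : Fin (m + 1)) (z : Fin (m + 1) → ℂ) (hz : z r = 0) :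
    (1 - vecMulVec (Pi.single r (1 : ℂ)) z).adjugate = 1 + vecMulVec (Pi.single r (1 : ℂ)) z := by
  set g := 1 - vecMulVec (Pi.single r (1 : ℂ)) z with hg
  set g' := 1 + vecMulVec (Pi.single r (1 : ℂ)) z with hg'
  have h1 : g * g.adjugate = 1 := by
    rw [Matrix.mul_adjugate, det_one_sub_vecMulVec_single r z hz, one_smul]
  have h2 : g' * g = 1 := mul_eq_one_comm.mp (one_sub_vecMulVec_mul_one_add r z hz)
  calc g.adjugate = g' * g * g.adjugate := by rw [h2, Matrix.one_mul]
    _ = g' := by rw [Matrix.mul_assoc, h1, Matrix.mul_one]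

/-! ### (D3): the adjugate of the test point -/

/-- **(D3) `adj(A(Ω,y)) = det Ω · y yᵀ`** for the corank-one skew test point
`A(Ω,y) = R_r(Ω) + e_r uᵀ − u e_rᵀ`, `u = R_r(Ω)·y`, `y_r = 1`, `Ω` skew (memo §1 (D3): conjugate
`adj(R_rΩ) = detΩ·E_rr` (`adjugate_padAt`) by `g = 1 − e_r(y − e_r)ᵀ`, `det g = 1`, `g⁻ᵀe_r = y`).
[cite: LandsbergManivelRessayre2013, §3.5 (p. 481)] -/
theorem adjugate_padAt_add_wedge (r : Fin (m + 1)) {Ω : Matrix (Fin m) (Fin m) ℂ} (hΩ : Ωᵀ = -Ω)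
    (y : Fin (m + 1) → ℂ) (hy : y r = 1) :
    (padAt r Ω + (vecMulVec (Pi.single r (1 : ℂ)) (padAt r Ω *ᵥ y) -
        vecMulVec (padAt r Ω *ᵥ y) (Pi.single r (1 : ℂ)))).adjugate =
      Ω.det • vecMulVec y y := by
  set e : Fin (m + 1) → ℂ := Pi.single r 1 with he
  set z : Fin (m + 1) → ℂ := y - e with hz
  have hzr : z r = 0 := by simp [hz, he, hy]
  have hee : e ⬝ᵥ e = 1 := by simp [he]
  rw [← conj_padAt_eq r hΩ y hy, Matrix.adjugate_mul_distrib, Matrix.adjugate_mul_distrib,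
    ← Matrix.adjugate_transpose, adjugate_one_sub_vecMulVec_single r z hzr, adjugate_padAt, Matrix.transpose_add,
    Matrix.transpose_one, Matrix.transpose_vecMulVec, Matrix.single_eq_single_vecMulVec_single]
  have hE : vecMulVec e e * (1 + vecMulVec e z) = vecMulVec e y := by
    rw [Matrix.mul_add, Matrix.mul_one, Matrix.vecMulVec_mul_vecMulVec, hee, one_smul]
    ext i j; simp only [Matrix.add_apply, Matrix.vecMulVec_apply, hz, Pi.sub_apply]; ring
  have hF : (1 + vecMulVec z e) * vecMulVec e y = vecMulVec y y := by
    rw [Matrix.add_mul, Matrix.one_mul, Matrix.vecMulVec_mul_vecMulVec, dotProduct_comm, hee, one_smul]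
    ext i j; simp only [Matrix.add_apply, Matrix.vecMulVec_apply, hz, Pi.sub_apply]; ring
  rw [Matrix.smul_mul, hE, Matrix.mul_smul, hF]

/-- The test point `A(Ω,y)` is skew (for `Ω` skew). [cite: LandsbergManivelRessayre2013, §3.5 (p. 481)] -/
theorem transpose_padAt_add_wedge (r : Fin (m + 1)) {Ω : Matrix (Fin m) (Fin m) ℂ} (hΩ : Ωᵀ = -Ω)
    (y : Fin (m + 1) → ℂ) :
    (padAt r Ω + (vecMulVec (Pi.single r (1 : ℂ)) (padAt r Ω *ᵥ y) -
        vecMulVec (padAt r Ω *ᵥ y) (Pi.single r (1 : ℂ))))ᵀ =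
      -(padAt r Ω + (vecMulVec (Pi.single r (1 : ℂ)) (padAt r Ω *ᵥ y) -
        vecMulVec (padAt r Ω *ᵥ y) (Pi.single r (1 : ℂ)))) := by
  rw [Matrix.transpose_add, Matrix.transpose_sub, Matrix.transpose_vecMulVec, Matrix.transpose_vecMulVec,
    padAt_transpose, hΩ]
  have hneg : padAt r (-Ω) = -padAt r Ω := by
    ext a b
    rcases Fin.eq_self_or_eq_succAbove r a with rfl | ⟨a', rfl⟩
    · simp
    · rcases Fin.eq_self_or_eq_succAbove r b with rfl | ⟨b', rfl⟩
      · simp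
      · simp
  rw [hneg]
  abel

/-- **Trace form of (D3)**: `tr(adj(A(Ω,y))·N) = det Ω · (y ⬝ (N y))`-shape, precisely
`det Ω · (y ⬝ᵥ (y ᵥ* N))`. [cite: LandsbergManivelRessayre2013, §3.5 (p. 481)] -/
theorem trace_adjugate_padAt_add_wedge_mul (r : Fin (m + 1)) {Ω : Matrix (Fin m) (Fin m) ℂ} (hΩ : Ωᵀ = -Ω)
    (y : Fin (m + 1) → ℂ) (hy : y r = 1) (N : Matrix (Fin (m + 1)) (Fin (m + 1)) ℂ) :
    ((padAt r Ω + (vecMulVec (Pi.single r (1 : ℂ)) (padAt r Ω *ᵥ y) -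
        vecMulVec (padAt r Ω *ᵥ y) (Pi.single r (1 : ℂ)))).adjugate * N).trace =
      Ω.det * (y ⬝ᵥ (y ᵥ* N)) := by
  rw [adjugate_padAt_add_wedge r hΩ y hy, Matrix.smul_mul, Matrix.trace_smul, Matrix.vecMulVec_mul,
    Matrix.trace_vecMulVec, smul_eq_mul]

/-! ### (c): a symmetric matrix orthogonal to all skew adjugates vanishes -/

/-- An invertible skew matrix of even size `h + h`, `h ≥ 1` (a signed perfect-matching matrix `J(π,s)`).
[cite: LandsbergManivelRessayre2013, §3.5 (p. 481)] -/
theorem exists_skew_isUnit_det {h : ℕ} (hh : 1 ≤ h) :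
    ∃ Ω : Matrix (Fin (h + h)) (Fin (h + h)) ℂ, Ωᵀ = -Ω ∧ IsUnit Ω.det := by
  have hab : (⟨0, by omega⟩ : Fin (h + h)) ≠ ⟨1, by omega⟩ := by simp
  obtain ⟨π, hπ, hfix, -⟩ := exists_involution_apply_eq hab
  refine ⟨pairMat π (fun x => if x < π x then (1 : ℂ) else -1), pairMat_transpose hπ (signWeight_antisymm hπ hfix),
    isUnit_det_pairMat hπ (signWeight_antisymm hπ hfix) (signWeight_ne_zero π)⟩

/-- **(c) A symmetric `N` with `tr(adj(A)·N) = 0` for all skew `A` is zero** (`n = h+h+1 ≥ 3`): by (D3) the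
hypothesis at `A(Ω,y)` gives `yᵀNy = 0` for every `y` with `y_r = 1`; the points `e_r` and `e_r + e_s` suffice.
This is the `(L_X S)_sym` half of block (III) of the stabiliser of `P_Λ` once `(L_X A)_skew = 0` (memo §5, last
bullet). [cite: LandsbergManivelRessayre2013, §3.5 (p. 481)] -/
theorem eq_zero_of_forall_skew_trace_adjugate_mul {h : ℕ} (hh : 1 ≤ h)
    {N : Matrix (Fin (h + h + 1)) (Fin (h + h + 1)) ℂ} (hN : Nᵀ = N)
    (hyp : ∀ A : Matrix (Fin (h + h + 1)) (Fin (h + h + 1)) ℂ, Aᵀ = -A → (A.adjugate * N).trace = 0) :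
    N = 0 := by
  obtain ⟨Ω, hΩ, hΩu⟩ := exists_skew_isUnit_det hh
  -- `yᵀ N y = 0` whenever `y_r = 1`
  have hq : ∀ (r : Fin (h + h + 1)) (y : Fin (h + h + 1) → ℂ), y r = 1 → y ⬝ᵥ (y ᵥ* N) = 0 := by
    intro r y hy
    have h0 := hyp _ (transpose_padAt_add_wedge r hΩ y)
    rw [trace_adjugate_padAt_add_wedge_mul r hΩ y hy, mul_eq_zero] at h0
    rcases h0 with h0 | h0
    · exact absurd h0 hΩu.ne_zero
    · exact h0
  have hform : ∀ y : Fin (h + h + 1) → ℂ, y ⬝ᵥ (y ᵥ* N) = ∑ i, ∑ j, y i * N i j * y j := by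
    intro y
    simp only [dotProduct, Matrix.vecMul, Finset.mul_sum]
    rw [Finset.sum_comm]
    exact Finset.sum_congr rfl fun i _ => Finset.sum_congr rfl fun j _ => by ring
  have hsingle : ∀ (r : Fin (h + h + 1)) (v : Fin (h + h + 1) → ℂ),
      (∑ i, ∑ j, (Pi.single r (1 : ℂ) : Fin (h + h + 1) → ℂ) i * N i j * v j) = ∑ j, N r j * v j := by
    intro r v
    rw [Finset.sum_eq_single r]
    · simp
    · intro i _ hi
      simp [Pi.single_eq_of_ne hi]
    · exact fun hr => absurd (Finset.mem_univ r) hr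
  have hsingle' : ∀ (r s : Fin (h + h + 1)),
      (∑ j, N r j * (Pi.single s (1 : ℂ) : Fin (h + h + 1) → ℂ) j) = N r s := by
    intro r s
    rw [Finset.sum_eq_single s]
    · simp
    · intro j _ hj
      simp [Pi.single_eq_of_ne hj]
    · exact fun hs => absurd (Finset.mem_univ s) hs
  have hdiag : ∀ r, N r r = 0 := by
    intro r
    have h0 := hq r (Pi.single r (1 : ℂ)) (by simp)
    rwa [hform, hsingle, hsingle'] at h0
  ext r s
  rw [Matrix.zero_apply]
  by_cases hrs : r = s
  · subst hrs; exact hdiag r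
  have h0 := hq r ((Pi.single r (1 : ℂ) : Fin (h + h + 1) → ℂ) + Pi.single s (1 : ℂ))
    (by simp [hrs])
  rw [hform] at h0
  simp only [Pi.add_apply, add_mul, mul_add, Finset.sum_add_distrib, hsingle, hsingle'] at h0
  rw [hdiag r, hdiag s] at h0
  have hsym : N s r = N r s := by
    have := congrFun (congrFun hN r) s
    rwa [Matrix.transpose_apply] at this
  rw [hsym] at h0
  linear_combination h0 / 2

end SkewAdj

end Literature.Computability.AlgebraicComplexity

end
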